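import Mathlib
import Literature.NumberTheory.EllipticCurves.IwasawaEulerCharProofs

/-!
# `stub_heegnerIndexLowerAtTwo` — stub-ideation k = 3 (gen 27):
# R181 EXECUTED AS A CUT INTO TREE THEOREMS — atom A of the H4 cut is the `Γ`-Euler characteristic
# of `IwasawaEulerCharProofs.lean`, and k3-g25's `DescentLemmaOneSidedRankOne p` is PROVED (every `p`)

Crux `SplitBadTwoLowerHalfOfFacts` (item `stmt-BirchSwinnertonDyer-27851`, route `PrintCf2`), stub
`stub_heegnerIndexLowerAtTwo` of the registered skeleton `kside_finite_two` v2. TECHNIQUE (k = 3):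
decomposition with a PROVED glue — here the node is row 73's atom **A** (`v([T¹]f) ≤ v#coker φ`,
STUB-PLAN v4.9 **R181**: "`DescentLemmaOneSidedRankOne 2` — Lean-M, cyclic-filtration induction"),
and the sub-stubs it is cut into are ALREADY THEOREMS of the tree file
`Literature/NumberTheory/EllipticCurves/IwasawaEulerCharProofs.lean` (generic `Λ = ℤ_p⟦T⟧` algebra,
every prime `p`, no named fact):

* A-ord  `order_charGenerator_eq_coinvariantsRank_iff_finite_ker_bockstein`
         (`ord_T f = rank_{ℤ_p} X_Γ ↔ ker φ_X finite`);
* A-sym  `finite_ker_bockstein_iff_finite_coker_bockstein` (Herbrand symmetry: `ker φ` finite iff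
         `coker φ` finite);
* A-dev  `card_coinvariants_of_lengthAt_eq_zero` + `kerBocksteinEquiv` / `cokerBocksteinEquiv` +
         `eulerExp_TSubmodule` (dévissage: `#coker φ_X = #ker φ_X · p^{e(X)}`);
* A-lead `coeff_lengthAt_charGenerator_eq_unit_mul_pow` (`coeff_{ord f} f = U · p^{e(X)}`, `U ∈ ℤ_pˣ`);
* A-fac  Mathlib `PowerSeries.X_dvd_iff` / `order_eq_nat` (`ord f = 1 ⟹ f = T·g`, `g(0) = coeff₁ f`).

GLUE PROVED below (0 `sorry`): the TWO-SIDED atom `atomA_exact` (`f = T·g`, `g(0) = U·p^{e(X)}`,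
`#coker φ_X = #ker φ_X · p^{e(X)}`) and — through two bridges that are also proved here,
H-T (transport `QuotSMulTop T X ≃ coinvariants p X`, `invToCoinv ↦ bockstein`) and
H-R (an ADDITIVE `π : X_Γ →+ ℤ_p` with finite kernel and finite-index image forces
`coinvariantsRank p X = 1`; additive ⟹ `ℤ_p`-linear by `p`-adic approximation, then rank–nullity over
the domain `ℤ_p`) — k3-g25's atom **verbatim**:
`descentLemmaOneSidedRankOne_holds : DescentLemmaOneSidedRankOne p` for every prime `p`
(`example : DescentLemmaOneSidedRankOne 2`). The new digit the exact form exposes is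
`kφ := v#ker φ_X = v#(X[T] ∩ TX)` with `v([T¹]f) = cφ − kφ` (§6: the H4 ledger re-glued with it).

HONEST FRAMING. Nothing here proves BSD, the crux, the stub or H4: what is proved is commutative
algebra over `Λ` (atom A of the five-atom cut A/B/C/L/E of row 73) plus integer bookkeeping; atoms
B / C / L (control⁻, the Nekovář dictionary R180, the dyadic local table R182) are untouched.
-/

set_option linter.dupNamespace false

noncomputable section

universe u

namespace Summit.BirchSwinnertonDyer.BirchSwinnertonDyer.Cruxes.SplitBadTwoLowerHalfOfFacts.StubIdeasK3G27

open Literature.NumberTheory.EllipticCurves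
open Literature.NumberTheory.EllipticCurves.IwasawaAlgebra
open scoped Pointwise

variable (p : ℕ) [Fact p.Prime]

/-! ## §1 A-fac: `ord_T f = 1 ⟹ f = T · g`, `g(0) = coeff₁ f ≠ 0` (Mathlib) -/

/-- If a power series `f ∈ Λ = ℤ_p⟦T⟧` has order exactly `1` then `f = T · g` with
`g(0) = coeff₁ f ≠ 0`. [folklore] -/
theorem exists_eq_X_mul_of_order_eq_one (f : IwasawaAlgebra p) (hf : f.order = 1) :
    ∃ g : IwasawaAlgebra p, f = PowerSeries.X * g ∧
      PowerSeries.constantCoeff g = PowerSeries.coeff 1 f ∧ PowerSeries.constantCoeff g ≠ 0 := by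
  have h := (PowerSeries.order_eq_nat (φ := f) (n := 1)).mp (by rw [Nat.cast_one]; exact hf)
  obtain ⟨h1, h0⟩ := h
  have hc : PowerSeries.constantCoeff f = 0 := by
    rw [← PowerSeries.coeff_zero_eq_constantCoeff_apply]; exact h0 0 zero_lt_one
  obtain ⟨g, hg⟩ := PowerSeries.X_dvd_iff.mpr hc
  have hg1 : PowerSeries.constantCoeff g = PowerSeries.coeff 1 f := by
    rw [hg, ← PowerSeries.coeff_zero_eq_constantCoeff_apply]
    exact (PowerSeries.coeff_succ_X_mul 0 g).symm
  exact ⟨g, hg, hg1, hg1 ▸ h1⟩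

/-! ## §2 Atom A, two-sided, over the TREE vocabulary (`bockstein`, `coinvariantsRank`, `eulerExp`) -/

/-- **Atom A, exact form (A-ord ∘ A-sym ∘ A-dev ∘ A-lead ∘ A-fac), every prime `p`.**
For a finitely generated torsion `Λ`-module `X` with `char_Λ X = (f)`, `rank_{ℤ_p} X_Γ = 1` and
`coker(φ_X : X^Γ → X_Γ)` finite: `f = T · g` with `g(0) = U · p^{e(X)}` (`U ∈ ℤ_pˣ`,
`e(X) = eulerExp p X`) and `#coker φ_X = #ker φ_X · p^{e(X)}` — i.e. `v_p(g(0)) = v#coker φ_X − v#ker φ_X`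
(Perrin-Riou's lemme; CSS 2003 §3 (30)–(31); Greenberg LNM 1716 §4), assembled from the tree theorems
named in the header. [folklore] -/
theorem atomA_exact (X : Type u) [AddCommGroup X] [Module (IwasawaAlgebra p) X]
    [Module.Finite (IwasawaAlgebra p) X] (hX : Module.IsTorsion (IwasawaAlgebra p) X)
    (f : IwasawaAlgebra p) (hf : Module.charIdeal (IwasawaAlgebra p) X = Ideal.span {f})
    (hrank : coinvariantsRank p X = 1)
    (hfin : Finite (coinvariants p X ⧸ LinearMap.range (bockstein p X))) :
    ∃ g : IwasawaAlgebra p, ∃ U : ℤ_[p]ˣ, f = PowerSeries.X * g ∧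
      PowerSeries.constantCoeff g = U * (p : ℤ_[p]) ^ eulerExp p X ∧
      Nat.card (coinvariants p X ⧸ LinearMap.range (bockstein p X)) =
        Nat.card (LinearMap.ker (bockstein p X)) * p ^ eulerExp p X := by
  -- A-sym
  have hker : Finite (LinearMap.ker (bockstein p X)) :=
    (finite_ker_bockstein_iff_finite_coker_bockstein p X hX).mpr hfin
  -- A-ord
  have hord : f.order = 1 := by
    rw [(order_charGenerator_eq_coinvariantsRank_iff_finite_ker_bockstein p X hX f hf).mpr hker,
      hrank, Nat.cast_one]
  -- A-fac
  obtain ⟨g, hfg, hg1, -⟩ := exists_eq_X_mul_of_order_eq_one p f hord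
  -- A-lead : `coeff_{ℓ_𝔭(X)} f = U p^{e(X)}` and `ℓ_𝔭(X) = ord f = 1`
  obtain ⟨U, hU⟩ := coeff_lengthAt_charGenerator_eq_unit_mul_pow p X hX f hf
  have hℓ : (Module.lengthAt (IwasawaAlgebra p) X (primeT p)).toNat = 1 := by
    have h := order_eq_toNat_lengthAt p hX f hf (primeT p) (primeT_asIdeal p)
    rw [hord] at h
    have h' : ((Module.lengthAt (IwasawaAlgebra p) X (primeT p)).toNat : ℕ∞) = (1 : ℕ) := by
      rw [← h, Nat.cast_one]
    exact_mod_cast h'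
  rw [hℓ] at hU
  -- A-dev : `#(N/TN) = #N[T] · p^{e(N)}` for `N = TX`, transported to `coker φ`, `ker φ`
  haveI : Module.Finite (IwasawaAlgebra p) (TSubmodule p X) :=
    Module.Finite.of_injective _ (Submodule.subtype_injective _)
  have hN : Module.IsTorsion (IwasawaAlgebra p) (TSubmodule p X) :=
    isTorsion_of_injective _ (Submodule.subtype_injective _) hX
  have hℓN : Module.lengthAt (IwasawaAlgebra p) (TSubmodule p X) (primeT p) = 0 := by
    rw [lengthAt_TSubmodule_eq_zero_iff p X hX]
    exact (finite_iff_lengthAt_eq_zero_of_X_smul_eq_zero p (LinearMap.ker (bockstein p X))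
      (fun x ↦ Subtype.ext (X_smul_invariants p X (x : invariants p X)))).mp hker
  obtain ⟨-, -, hcard⟩ := card_coinvariants_of_lengthAt_eq_zero (TSubmodule p X) hN hℓN
  rw [eulerExp_TSubmodule p X hX, ← Nat.card_congr (kerBocksteinEquiv p X),
    ← Nat.card_congr (cokerBocksteinEquiv p X).toEquiv] at hcard
  exact ⟨g, U, hfg, by rw [hg1, hU], hcard⟩

/-- The digit corollary used by LOWER: `p^{e(X)} ∣ #coker φ_X`, `g(0) ∼ p^{e(X)}`; hence if
`#coker φ_X ∣ p^c` then `p^{c+1} ∤ g(0)` (and `g(0) ≠ 0`). [folklore] -/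
theorem not_pow_succ_dvd_of_unit_mul_pow {a : ℤ_[p]} (U : ℤ_[p]ˣ) {e k m c : ℕ}
    (ha : a = U * (p : ℤ_[p]) ^ e) (hm : m = k * p ^ e) (hmc : m ∣ p ^ c) :
    a ≠ 0 ∧ ¬ (p : ℤ_[p]) ^ (c + 1) ∣ a := by
  have hp : p.Prime := Fact.out
  have hp0 : (p : ℤ_[p]) ≠ 0 := by exact_mod_cast hp.ne_zero
  have hpu : ¬ IsUnit (p : ℤ_[p]) := PadicInt.irreducible_p.not_isUnit
  refine ⟨?_, ?_⟩
  · rw [ha]; exact mul_ne_zero (Units.ne_zero U) (pow_ne_zero _ hp0)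
  · intro hdvd
    -- `e ≤ c` from `k p^e ∣ p^c`, `k ≠ 0`
    have hec : e ≤ c := by
      have h1 : p ^ e ∣ p ^ c := Dvd.dvd.trans (Dvd.intro_left k hm.symm) hmc
      exact (Nat.pow_dvd_pow_iff_le_right hp.one_lt).mp h1
    rw [ha, (Units.isUnit U).dvd_mul_left] at hdvd
    have := (pow_dvd_pow_iff hp0 hpu).mp hdvd
    omega

/-! ## §3 Bridge H-R: an additive `π : Y →+ ℤ_p` with finite kernel and finite-index image forces
`rank_{ℤ_p} Y = 1` (for the restricted `ℤ_p`-structure of a `Λ`-module) -/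

section RankOne

variable {p}
variable (Y : Type) [AddCommGroup Y] [Module (IwasawaAlgebra p) Y]

/-- Automatic `ℤ_p`-linearity: an additive map `π : Y → ℤ_p` out of a `Λ`-module commutes with the
restricted `ℤ_p`-action — `π(c·y) − c·π(y) ∈ p^n ℤ_p` for every `n` by `p`-adic approximation of
`c` by naturals (`PadicInt.appr`), hence it vanishes. [folklore] -/
theorem map_smul_eq_mul (π : Y →+ ℤ_[p]) (c : ℤ_[p]) (y : Y) :
    letI : Module ℤ_[p] Y := Module.compHom _ (algebraMap ℤ_[p] (IwasawaAlgebra p))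
    π (c • y) = c * π y := by
  letI : Module ℤ_[p] Y := Module.compHom _ (algebraMap ℤ_[p] (IwasawaAlgebra p))
  have key : ∀ (n : ℕ) (c : ℤ_[p]) (y : Y),
      π (c • y) - c * π y ∈ (Ideal.span {(p : ℤ_[p]) ^ n} : Ideal ℤ_[p]) := by
    intro n c y
    obtain ⟨d, hd⟩ := Ideal.mem_span_singleton'.mp (PadicInt.appr_spec n c)
    have hc : c = (c.appr n : ℤ_[p]) + (p : ℤ_[p]) ^ n * d := by
      rw [mul_comm] at hd; rw [hd]; ring
    have hnat : ∀ (m : ℕ) (z : Y), π ((m : ℤ_[p]) • z) = (m : ℤ_[p]) * π z := by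
      intro m z
      rw [Nat.cast_smul_eq_nsmul, map_nsmul, nsmul_eq_mul]
    have h1 : π (c • y) = (c.appr n : ℤ_[p]) * π y + (p : ℤ_[p]) ^ n * π (d • y) := by
      conv_lhs => rw [hc]
      rw [add_smul, map_add, mul_smul, hnat, ← Nat.cast_pow, hnat]
    refine Ideal.mem_span_singleton'.mpr ⟨π (d • y) - d * π y, ?_⟩
    linear_combination -h1 - (π y) * hd
  by_contra hne
  have hne' : π (c • y) - c * π y ≠ 0 := sub_ne_zero.mpr hne
  have h := (PadicInt.mem_span_pow_iff_le_valuation _ hne'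
    ((π (c • y) - c * π y).valuation + 1)).mp (key _ c y)
  omega

/-- **H-R.** If `π : Y →+ ℤ_p` is additive with finite kernel and image of finite index, then
`rank_{ℤ_p} Y = 1` (restricted structure; rank–nullity over the domain `ℤ_p`, Mathlib
`IsDomain.hasRankNullity`). [folklore] -/
theorem finrank_eq_one_of_addMonoidHom (π : Y →+ ℤ_[p]) (hker : Finite π.ker)
    (hfi : π.range.FiniteIndex) :
    letI : Module ℤ_[p] Y := Module.compHom _ (algebraMap ℤ_[p] (IwasawaAlgebra p))
    Module.finrank ℤ_[p] Y = 1 := by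
  letI : Module ℤ_[p] Y := Module.compHom _ (algebraMap ℤ_[p] (IwasawaAlgebra p))
  let πL : Y →ₗ[ℤ_[p]] ℤ_[p] :=
    { toFun := π, map_add' := π.map_add, map_smul' := fun c y => map_smul_eq_mul Y π c y }
  have hπL : ∀ y, πL y = π y := fun _ => rfl
  -- the kernel has rank 0 (finite ⟹ torsion over the infinite domain `ℤ_p`)
  have hkerL : Module.rank ℤ_[p] (LinearMap.ker πL) = 0 := by
    rw [rank_eq_zero_iff_isTorsion]
    haveI : Finite (LinearMap.ker πL) := by
      refine Finite.of_injective (fun x : LinearMap.ker πL => (⟨x.1, x.2⟩ : π.ker)) ?_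
      intro a b h
      exact Subtype.ext (congrArg Subtype.val h)
    haveI : Infinite ℤ_[p] := Infinite.of_injective _ (Nat.cast_injective (R := ℤ_[p]))
    intro x
    obtain ⟨a, b, hab, h⟩ :=
      Finite.exists_ne_map_eq_of_infinite (fun c : ℤ_[p] => c • x)
    refine ⟨⟨a - b, mem_nonZeroDivisors_of_ne_zero (sub_ne_zero.mpr hab)⟩, ?_⟩
    show (a - b) • x = 0
    rw [sub_smul, sub_eq_zero]
    exact h
  -- the image has rank 1 (a non-zero ideal of `ℤ_p`)
  have hrangeL : Module.rank ℤ_[p] (LinearMap.range πL) = 1 := by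
    apply le_antisymm
    · exact (Submodule.rank_le _).trans_eq (Module.rank_self _)
    · haveI : Infinite ℤ_[p] := Infinite.of_injective _ (Nat.cast_injective (R := ℤ_[p]))
      have hne : LinearMap.range πL ≠ ⊥ := by
        intro hbotL
        have hbot : π.range = ⊥ := by
          rw [eq_bot_iff]
          rintro x ⟨y, rfl⟩
          have hy : πL y ∈ LinearMap.range πL := LinearMap.mem_range_self πL y
          rw [hbotL, Submodule.mem_bot] at hy
          exact AddSubgroup.mem_bot.mpr hy
        have h0 : π.range.index = 0 := by
          rw [hbot, AddSubgroup.index_bot]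
          exact Nat.card_eq_zero_of_infinite
        exact hfi.index_ne_zero h0
      obtain ⟨x, hx, hx0⟩ := Submodule.exists_mem_ne_zero_of_ne_bot hne
      haveI : Nontrivial (LinearMap.range πL) :=
        ⟨⟨⟨x, hx⟩, 0, fun h => hx0 (congrArg Subtype.val h)⟩⟩
      exact Cardinal.one_le_iff_pos.mpr rank_pos
  have htot := LinearMap.rank_range_add_rank_ker πL
  rw [hrangeL, hkerL, add_zero] at htot
  exact Module.finrank_eq_of_rank_eq (by rw [← htot, Nat.cast_one])

/-- H-R for the `Γ`-coinvariants: `coinvariantsRank p X = 1`. [folklore] -/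
theorem coinvariantsRank_eq_one_of_addMonoidHom (X : Type) [AddCommGroup X]
    [Module (IwasawaAlgebra p) X] (π : coinvariants p X →+ ℤ_[p]) (hker : Finite π.ker)
    (hfi : π.range.FiniteIndex) : coinvariantsRank p X = 1 := by
  rw [coinvariantsRank_eq_finrank_int]
  exact finrank_eq_one_of_addMonoidHom (coinvariants p X) π hker hfi

end RankOne

/-! ## §4 Bridge H-T: `QuotSMulTop T X ≃ coinvariants p X` carries k3-g25's `invToCoinv` to the
tree's `bockstein` -/

section Transport

variable (X : Type u) [AddCommGroup X] [Module (IwasawaAlgebra p) X]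

/-- k3-g25's invariants-to-coinvariants map, VERBATIM (`STUB_IDEAS_…_3_g25.lean` §3). -/
def invToCoinv :
    Submodule.torsionBy (IwasawaAlgebra p) X (PowerSeries.X : IwasawaAlgebra p) →ₗ[IwasawaAlgebra p]
      QuotSMulTop (PowerSeries.X : IwasawaAlgebra p) X :=
  ((PowerSeries.X : IwasawaAlgebra p) • (⊤ : Submodule (IwasawaAlgebra p) X)).mkQ ∘ₗ
    (Submodule.torsionBy (IwasawaAlgebra p) X (PowerSeries.X : IwasawaAlgebra p)).subtype

/-- `T • X = (T) • X` as submodules (Mathlib `Submodule.ideal_span_singleton_smul`). [folklore] -/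
theorem smul_top_eq_TSubmodule :
    (PowerSeries.X : IwasawaAlgebra p) • (⊤ : Submodule (IwasawaAlgebra p) X) = TSubmodule p X :=
  (Submodule.ideal_span_singleton_smul _ _).symm

/-- The identification `QuotSMulTop T X ≃ₗ[Λ] coinvariants p X = X/(T)X`. [folklore] -/
def quotSMulTopEquiv :
    QuotSMulTop (PowerSeries.X : IwasawaAlgebra p) X ≃ₗ[IwasawaAlgebra p] coinvariants p X :=
  Submodule.quotEquivOfEq _ _ (smul_top_eq_TSubmodule p X)

/-- Under the identification, `im(invToCoinv) ↦ im(bockstein)`. [folklore] -/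
theorem map_range_invToCoinv :
    (LinearMap.range (invToCoinv p X)).map (quotSMulTopEquiv p X).toLinearMap =
      LinearMap.range (bockstein p X) := by
  have hcomp : (quotSMulTopEquiv p X).toLinearMap ∘ₗ
      ((PowerSeries.X : IwasawaAlgebra p) • (⊤ : Submodule (IwasawaAlgebra p) X)).mkQ =
        (TSubmodule p X).mkQ := by
    ext x; rfl
  rw [invToCoinv, bockstein, LinearMap.range_comp, LinearMap.range_comp]
  simp only [Submodule.range_subtype, ← Submodule.map_comp, hcomp]

/-- The cokernels of `invToCoinv` and `bockstein` are isomorphic. [folklore] -/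
def cokerEquiv :
    (QuotSMulTop (PowerSeries.X : IwasawaAlgebra p) X ⧸ LinearMap.range (invToCoinv p X))
      ≃ₗ[IwasawaAlgebra p] (coinvariants p X ⧸ LinearMap.range (bockstein p X)) :=
  Submodule.Quotient.equiv _ _ (quotSMulTopEquiv p X) (map_range_invToCoinv p X)

end Transport

/-! ## §5 k3-g25's atom A VERBATIM — PROVED for every prime `p` (R181) -/

/-- **Atom A, typed** — token for token k3-g25's `DescentLemmaOneSidedRankOne`
(`STUB_IDEAS_stub_heegnerIndexLowerAtTwo_3_g25.lean`, §3; STUB-PLAN v4.9 R181). -/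
def DescentLemmaOneSidedRankOne : Prop :=
  ∀ (X : Type) [AddCommGroup X] [Module (IwasawaAlgebra p) X] [Module.Finite (IwasawaAlgebra p) X],
    Module.IsTorsion (IwasawaAlgebra p) X →
  ∀ (f : IwasawaAlgebra p), Module.charIdeal (IwasawaAlgebra p) X = Ideal.span {f} →
  ∀ (π : QuotSMulTop (PowerSeries.X : IwasawaAlgebra p) X →+ ℤ_[p]),
    Finite π.ker → π.range.FiniteIndex →
  ∀ (c : ℕ), Nat.card (QuotSMulTop (PowerSeries.X : IwasawaAlgebra p) X ⧸
      (LinearMap.range (invToCoinv p X)).toAddSubgroup) ∣ p ^ c →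
    ∃ g : IwasawaAlgebra p, f = PowerSeries.X * g ∧
      PowerSeries.constantCoeff g ≠ 0 ∧
      ¬ ((p : ℤ_[p]) ^ (c + 1) ∣ PowerSeries.constantCoeff g)

/-- **R181 CLOSED (every prime `p`): k3-g25's atom A holds.** Proof = A-ord ∘ A-sym ∘ A-dev ∘ A-lead ∘
A-fac (`atomA_exact`, tree theorems) after the bridges H-T (`cokerEquiv`) and H-R
(`coinvariantsRank_eq_one_of_addMonoidHom`). [folklore] -/
theorem descentLemmaOneSidedRankOne_holds : DescentLemmaOneSidedRankOne p := by
  intro X _ _ _ hX f hf π hker hfi c hc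
  have hp : p.Prime := Fact.out
  -- H-T : the two cokernels have the same order
  have hcard : Nat.card (QuotSMulTop (PowerSeries.X : IwasawaAlgebra p) X ⧸
      (LinearMap.range (invToCoinv p X)).toAddSubgroup) =
        Nat.card (coinvariants p X ⧸ LinearMap.range (bockstein p X)) :=
    Nat.card_congr (cokerEquiv p X).toEquiv
  rw [hcard] at hc
  have hfin : Finite (coinvariants p X ⧸ LinearMap.range (bockstein p X)) := by
    refine Nat.finite_of_card_ne_zero (fun h0 => ?_)
    rw [h0] at hc
    exact pow_ne_zero c hp.ne_zero (Nat.eq_zero_of_zero_dvd hc)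
  -- H-R : transport `π` along the identification and read off `rank_{ℤ_p} X_Γ = 1`
  let e := quotSMulTopEquiv p X
  let π' : coinvariants p X →+ ℤ_[p] := π.comp e.symm.toLinearMap.toAddMonoidHom
  have hπ' : ∀ y, π' y = π (e.symm y) := fun _ => rfl
  have hker' : Finite π'.ker := by
    refine Finite.of_injective (fun y : π'.ker => (⟨e.symm y.1, y.2⟩ : π.ker)) ?_
    intro a b h
    have h' : e.symm a.1 = e.symm b.1 := congrArg Subtype.val h
    exact Subtype.ext (e.symm.injective h')
  have hrange : π'.range = π.range := by
    ext x
    constructor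
    · rintro ⟨y, rfl⟩; exact ⟨e.symm y, rfl⟩
    · rintro ⟨z, rfl⟩; exact ⟨e z, by rw [hπ', LinearEquiv.symm_apply_apply]⟩
  have hfi' : π'.range.FiniteIndex := by rw [hrange]; exact hfi
  have hrank : coinvariantsRank p X = 1 := coinvariantsRank_eq_one_of_addMonoidHom X π' hker' hfi'
  -- atom A (two-sided) and the LOWER digit
  obtain ⟨g, U, hfg, hgU, hcoker⟩ := atomA_exact p X hX f hf hrank hfin
  obtain ⟨hg0, hndvd⟩ := not_pow_succ_dvd_of_unit_mul_pow p U hgU hcoker hc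
  exact ⟨g, hfg, hg0, hndvd⟩

/-- In particular at `p = 2` (the stub's prime): R181 as posed. -/
example : DescentLemmaOneSidedRankOne 2 := by
  haveI : Fact (Nat.Prime 2) := ⟨Nat.prime_two⟩
  exact descentLemmaOneSidedRankOne_holds 2

/-! ## §6 PLAN 2 — the H4 ledger re-glued with the EXACT A-step (new digit `kφ = v#ker φ_X`) -/

/-- Row 73's one-sided chain with atom A replaced by the exact identity `vlead + kφ = cφ`
(`atomA_exact`): the stub-shaped conclusion follows as soon as the net local/Bockstein slack
`t₁ + t₂ + a₁ + a₂ + c₀` is absorbed by Disegni's digit `ν` PLUS the free credit `kφ ≥ 0`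
(k3-g25 `stub_shape_of_cut` had `… ≤ ν`). PROVED integer arithmetic; nothing else is claimed. -/
theorem stub_shape_of_exact_cut
    (vlead kφ cφ kπ cψ cs vSha vTam t₁ t₂ a₁ a₂ c₀ vh vlogγ ι vc ν : ℤ)
    (hAexact : vlead + kφ = cφ)                      -- atom A⁼ (THIS FILE, `atomA_exact`)
    (hG1 : cφ ≤ kπ + cψ)                             -- brick G1 (k3-g25, PROVED)
    (hB : kπ ≤ vSha + t₁ + t₂ + cs ∧ cs ≤ vTam + a₁ + a₂)   -- atom B (control⁻)
    (hC : cψ ≤ c₀ + vh - vlogγ)                      -- atom C (Bockstein ⊇ 2^{c₀}·height; R180)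
    (hMC : 2 * ι - 2 * vc + (vh - vlogγ) + ν ≤ vlead) -- MC⁻ ∘ PRGZ₂ (road B⁻ head)
    (hbudget : t₁ + t₂ + a₁ + a₂ + c₀ ≤ ν + kφ) :     -- the RELAXED budget (K4)
    2 * ι - 2 * vc ≤ vSha + vTam := by
  obtain ⟨hB1, hB2⟩ := hB
  omega

/-- The exact A-step recovers k3-g25's one-sided atom A (`vlead ≤ cφ`) since `kφ ≥ 0`. -/
theorem atomA_oneSided_of_exact (vlead kφ cφ : ℤ) (h : vlead + kφ = cφ) (hk : 0 ≤ kφ) :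
    vlead ≤ cφ := by omega

/-! ## §7 PLAN 3 pointers — P10's helper H-A3 (`#ℤ_p/(x) = p^{v(x)}`), PROVED; H-B2 is the tree's
`card_of_exact_six`, H-A3 in `Λ`-clothing is the tree's `natCard_quotient_span_sup_span_X` -/

/-- **H-A3** (STUB-PLAN P10): `#(ℤ_p/(x)) = p^{v_p(x)}` for `x ≠ 0`. [folklore] -/
theorem natCard_quotient_span_singleton {x : ℤ_[p]} (hx : x ≠ 0) :
    Nat.card (ℤ_[p] ⧸ Ideal.span {x}) = p ^ x.valuation := by
  have hspan : Ideal.span {x} = RingHom.ker (PadicInt.toZModPow (p := p) x.valuation) := by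
    rw [PadicInt.ker_toZModPow, Ideal.span_singleton_eq_span_singleton]
    exact ⟨(PadicInt.unitCoeff hx)⁻¹,
      (Units.mul_inv_eq_iff_eq_mul _).mpr (by rw [mul_comm]; exact PadicInt.unitCoeff_spec hx)⟩
  rw [hspan, Nat.card_congr (RingHom.quotientKerEquivOfSurjective
    (ZMod.ringHom_surjective (PadicInt.toZModPow x.valuation))).toEquiv, Nat.card_zmod]

end Summit.BirchSwinnertonDyer.BirchSwinnertonDyer.Cruxes.SplitBadTwoLowerHalfOfFacts.StubIdeasK3G27

end
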